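import Summits.QuantumFields.BalabanUV.Beta.GAN24.AveragedPropagatorTowerCubic
import Summits.QuantumFields.BalabanUV.Beta.GAN24.AveragedPropagatorInverseOneStep
import Summits.QuantumFields.BalabanUV.Beta.GAN24.AveragedPropagatorInverseUniform
import Summits.QuantumFields.BalabanUV.T4Continuum.Support.VariationalDelKBridge

/-!
# G-an2-4 ∕ (CONV-C), road P2, VECTOR LAYER — THE TOWER OF THE INVERSES `k ↦ (c_{L^k}(1))⁻¹ = (Q_{L^k}𝒢_{L^k}Q_{L^k}*)⁻¹` (the `H_k`
# denominator ∕ NE2's `Δ_K^{(k)} + 1`) ON A CUBIC UNIT TORUS, `U = 1`, `a = 1`, sup → sup: k-UNIFORM BOUND, GEOMETRIC ONE-STEP RATE, NAMED LIMIT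
# `d_∞` WITH `‖(((c_{L^k})⁻¹ − d_∞)g)(i)‖ ≤ C₅·(1∕√L)^k·|g|_∞` UNIFORMLY IN THE TORUS, AND `d_∞ = c_∞⁻¹` — UNCONDITIONAL

G-an2-4 formalisation swarm `b2b-balaban-gan24-formalise-*`, leaf prover 04 (gen 50), crux team (2) under the coordinator ruling «YM REDIRECT»
(e34b3e0c; FREEZE (0) honoured — a `GAN24/` corollary importing EXISTING modules only; INTENT 2 «VECTOR-TOWER-INV», the road-P2 chair
`b2b-balaban-gan24-p2` (gen 30)'s invitation «tower packaging» of HOME/INBOX.md 2026-08-21 l.7847–7854).  INPUTS, BY NAME and nothing else estimated: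
the chair's Part 7 v2 `AveragedPropagatorInverseOneStep.norm_covOp_inv_succ_sub_mulVec_le_cubic` (p266164 — the inverse's one-step sup law,
unconditional through leaf-03 gen 50's (V-SINV) `AveragedPropagatorInverseUniform.covOp_inv_sup_one_cubic` p265411, used here also as the k-uniform
bound), `isUnit_covOp_det`, this lineage's `AveragedPropagatorTowerCubic` (p266003: `covOp_level_congr`, `mulVec_single_one_apply`, `norm_single_one_le`,
`tendsto_covOp_tower_cubic`), `ScalarUnitLatticeTower.tower_rate_le` (leaf-06), `T4FlagMemoryPolyWeight.succ_mul_pow_le` (lit), and for §5 NE2's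
definitions `BalabanAveragedCoerciveTower.covBlev` ∕ `BalabanHardMinimizer.DeltaKlev` with `AveragedPropagatorOneStepCubic.covOp_eq_covB`.  THIS FILE:
 * §1 **`tower_limit_of_bounds`** — an ABSTRACT finite-carrier lemma (p266003 §4 made generic): a matrix family `A : ℕ → Matrix ι ι ℂ` with a
   k-uniform sup → sup bound `C₀` and one-step bounds `C₄θ^k` (`0 ≤ θ < 1`) has a limit `A_∞` with `(A_kg)(i) → (A_∞g)(i)`,
   `‖((A_k − A_∞)g)(i)‖ ≤ (C₀ + C₄∕(1−θ))θ^k|g|_∞`, `‖(A_∞g)(i)‖ ≤ (C₀ + C₄∕(1−θ))|g|_∞` — reusable verbatim by any sup-currency tower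
   (e.g. the chair's coming kernel-currency `AveragedPropagatorOneStepDecay` line);
 * §2 **`norm_covOp_inv_tower_step_le_cubic`** — `∃ K′ > 0 (d)`: `‖(((c_{L^{k+1}})⁻¹ − (c_{L^k})⁻¹)g)(i)‖
   ≤ K′·(1 + log L)·(k+1)·L^{−k}·b` (Part 7 v2 at `N = L^k`, `R = L`), and **`convC_shape_covOp_inv_tower_cubic`** — the two clauses
   (`‖((c_{L^k})⁻¹g)(i)‖ ≤ σ·b` k-uniformly ∧ step `≤ C₄(d,L)·(1∕√L)^k·b`, `L ≥ 2`);
 * §3 **`tendsto_covOp_inv_tower_cubic`** — `∀ L ≥ 2, ∃ C₅ > 0 (d, L), ∀ N₀, ∃ d_∞, ∀ |g| ≤ b, ∀ i`: convergence, rate `C₅(1∕√L)^k b`, bound `C₅ b`;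
 * §4 `mul_eq_one_of_tendsto` (abstract), **`tendsto_covOp_tower_inv_eq`** — THE IDENTIFICATION: `c_{L^k} → c_∞` and `(c_{L^k})⁻¹ → d_∞`
   ENTRYWISE with **`c_∞⁻¹ = d_∞`** (`c_k·c_k⁻¹ = 1` passes to the entrywise limit on the FIXED finite carrier; `Matrix.inv_eq_right_inv`), and
   **`tendsto_covOp_and_inv_tower_cubic`** — ONE PACKAGE: both sup-currency towers (p266003 §4 and §3 here) with their limits named TOGETHER
   and `c_∞⁻¹ = d_∞`, one constant `C = max(C₅, D₅)`;
 * §5 the NE2 READING: `covBlev L T 1 _ k = covOp (L^k) T 1` (`covBlev_one_eq_covOp`) and **`DeltaKlev_one_eq`**: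
   `Δ_K^{(k)}(a = 1) = (c_{L^k}(1))⁻¹ − 1` ⇒ **`tendsto_DeltaKlev_one_cubic`**: `Δ_K^{(k)} → d_∞ − 1` in sup → sup currency with rate `C₅(1∕√L)^k`,
   N₀-UNIFORMLY — the ℓ^∞ companion of NE2-P1's ℓ²-operator-norm `BalabanHardMinimizer.DeltaKlev_tendsto` ∕ `BalabanAveragedCoerciveTower.covBlev_tendsto`
   (every torus, every `a`, rate `L^{−k}`).  REMARK (not used, not proved here): NE2's ℓ² statement does not yield an N₀-UNIFORM sup → sup
   bound (ℓ² → ℓ^∞ costs the size of the carrier), while a sup → sup bound of a Hermitian family dominates its ℓ²-operator norm — so the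
   present `(1∕√L)^k` is also an (unoptimised) ℓ² rate, NE2's `L^{−k}` being the sharper one there; the limit objects coincide by uniqueness
   of entrywise limits on a finite carrier.  NE2's statements are neither re-proved nor moved here.
HONEST SCOPE.  [folklore] corollaries BY NAME (one `obtain` per input + finite-dimensional real analysis); `U = 1`, `a = 1`, CUBIC unit tori in dimension
`d + 1`, the unit torus FIXED along the tower, sup → sup currency, the unit-lattice-read vector constituent and its inverse only (no decay clause, no
fine constituents `H_k` ∕ `G_k(1)`, no general `a`, nothing non-abelian); `θ = L^{−1∕2}` a typing convenience; limits NAMED on the finite carrier, NOT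
identified with any continuum ∕ Bałaban kernel; NO consumer predicate (`LimitForm.conv`, `DirichletExhaustion.ConvC`) instantiated.  The identification
`Δ_K = Δ_k` of [Balaban1984PropagatorsI] (1.65) is NE2's open dictionary step and is NOT claimed; (1.65) ∕ (1.99) ∕ (2.35) are TEXT LOCATIONS.  NOT
(CONV-C) as typed, NEVER «G-an2-4 closed», NOT NE2 ∕ NE3, NOT D1, NOT BetaPertH, NOT continuum, NOT Clay; 0 def, 0 `def … : Prop`, 0 cite tag, no
sorry — not in print, our bookkeeping.  HONEST DEPENDENCY: continuum YM on T⁴ ⇐ BetaPertH ∧ nine spine estimates (0/9 proved); BetaPertH ⇐ (D1) ∧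
(D4) ∧ CAP+tail; G-an2-4 gates asym, D1 and NE2/3/4.
-/

noncomputable section

open scoped BigOperators ComplexConjugate Matrix

namespace Summit.QuantumFields.BalabanUV.Beta.GAN24.AveragedPropagatorInverseTowerCubic

open Filter
open Literature.MathematicalPhysics.QuantumFieldTheory.Balaban1983to89
open B5Prop11Plancherel (Tor fine)
open B5G183RateUnitTower (lev)
open Summit.QuantumFields.BalabanUV.T4Continuum.BalabanAveragedTowerUnit (one_le_lev')
open Summit.QuantumFields.BalabanUV.T4Continuum.VariationalDelKBridge (lev_eq_pow)
open Summit.QuantumFields.BalabanUV.T4Continuum.BalabanAveragedCoerciveTower (covBlev)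
open Summit.QuantumFields.BalabanUV.T4Continuum.BalabanHardMinimizer (DeltaKlev)
open Summit.QuantumFields.BalabanUV.Beta.GAN24.AveragedPropagatorTwoLevel (covOp)
open Summit.QuantumFields.BalabanUV.Beta.GAN24.AveragedPropagatorOneStepCubic (covOp_eq_covB)
open Summit.QuantumFields.BalabanUV.Beta.GAN24.AveragedPropagatorInverseOneStep
  (isUnit_covOp_det norm_covOp_inv_succ_sub_mulVec_le_cubic)
open Summit.QuantumFields.BalabanUV.Beta.GAN24.AveragedPropagatorInverseUniform (covOp_inv_sup_one_cubic)
open Summit.QuantumFields.BalabanUV.Beta.GAN24.AveragedPropagatorTowerCubic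
  (covOp_level_congr mulVec_single_one_apply norm_single_one_le tendsto_covOp_tower_cubic)
open Summit.QuantumFields.BalabanUV.Beta.GAN24.ScalarUnitLatticeTower (tower_rate_le)
open T4FlagMemoryPolyWeight (succ_mul_pow_le)

/-! ## §1 An abstract finite-carrier lemma: sup-currency towers with geometric steps have a named limit with the same rate -/

/-- **TOWER LIMIT FROM SUP BOUNDS** (finite carrier `ι`, complex entries): if `‖(A_kg)(i)‖ ≤ C₀|g|_∞` for all `k` and
`‖((A_{k+1} − A_k)g)(i)‖ ≤ C₄θ^k|g|_∞` with `0 ≤ θ < 1`, then there is `A_∞` with `(A_kg)(i) → (A_∞g)(i)`,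
`‖((A_k − A_∞)g)(i)‖ ≤ (C₀ + C₄∕(1−θ))θ^k|g|_∞` and `‖(A_∞g)(i)‖ ≤ (C₀ + C₄∕(1−θ))|g|_∞` — entrywise `cauchySeq_of_le_geometric` through the unit
vectors, `Matrix.of` the limits, `mulVec` of the limit = limit of `mulVec` (finite sum), `dist_le_of_le_geometric_of_tendsto`. [folklore] -/
theorem tower_limit_of_bounds {ι : Type*} [Fintype ι] [DecidableEq ι] (A : ℕ → Matrix ι ι ℂ) {C₀ C₄ θ : ℝ}
    (hC₀ : 0 ≤ C₀) (hθ0 : 0 ≤ θ) (hθ1 : θ < 1)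
    (h0 : ∀ (k : ℕ) (g : ι → ℂ) (b : ℝ), (∀ j, ‖g j‖ ≤ b) → ∀ i, ‖(A k *ᵥ g) i‖ ≤ C₀ * b)
    (h1 : ∀ (k : ℕ) (g : ι → ℂ) (b : ℝ), (∀ j, ‖g j‖ ≤ b) → ∀ i, ‖((A (k + 1) - A k) *ᵥ g) i‖ ≤ C₄ * θ ^ k * b) :
    ∃ Ainf : Matrix ι ι ℂ, ∀ (g : ι → ℂ) (b : ℝ), (∀ j, ‖g j‖ ≤ b) → ∀ i,
      Tendsto (fun k : ℕ => (A k *ᵥ g) i) atTop (nhds ((Ainf *ᵥ g) i)) ∧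
      (∀ k : ℕ, ‖((A k - Ainf) *ᵥ g) i‖ ≤ (C₀ + C₄ / (1 - θ)) * θ ^ k * b) ∧
      ‖(Ainf *ᵥ g) i‖ ≤ (C₀ + C₄ / (1 - θ)) * b := by
  have h1θ : 0 < 1 - θ := by linarith
  -- Step 1: every entry is Cauchy, hence convergent
  have hent : ∀ i j : ι, ∃ s : ℂ, Tendsto (fun k : ℕ => A k i j) atTop (nhds s) := by
    intro i j
    have hstep : ∀ k : ℕ, dist (A k i j) (A (k + 1) i j) ≤ C₄ * 1 * θ ^ k := by
      intro k
      have h2 := h1 k (Pi.single j (1 : ℂ)) 1 (norm_single_one_le j) i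
      rw [Matrix.sub_mulVec, Pi.sub_apply, mulVec_single_one_apply, mulVec_single_one_apply] at h2
      rw [dist_comm, dist_eq_norm]
      linarith
    exact cauchySeq_tendsto_of_complete (cauchySeq_of_le_geometric θ (C₄ * 1) hθ1 hstep)
  choose Ainf hA using hent
  refine ⟨Matrix.of Ainf, fun g b hg i => ?_⟩
  have hb : 0 ≤ b := (norm_nonneg _).trans (hg i)
  -- Step 2: `mulVec` of the entrywise limit is the limit of `mulVec`
  have hlim : Tendsto (fun k : ℕ => (A k *ᵥ g) i) atTop (nhds ((Matrix.of Ainf *ᵥ g) i)) := by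
    simp only [Matrix.mulVec, dotProduct, Matrix.of_apply]
    exact tendsto_finsetSum _ fun j _ => (hA i j).mul tendsto_const_nhds
  -- Step 3: geometric summation along the convergent sequence
  have hstep : ∀ k : ℕ, dist ((A k *ᵥ g) i) ((A (k + 1) *ᵥ g) i) ≤ C₄ * b * θ ^ k := by
    intro k
    have h2 := h1 k g b hg i
    rw [Matrix.sub_mulVec, Pi.sub_apply] at h2
    rw [dist_comm, dist_eq_norm]
    linarith
  have hdist : ∀ k : ℕ, dist ((A k *ᵥ g) i) ((Matrix.of Ainf *ᵥ g) i) ≤ C₄ * b * θ ^ k / (1 - θ) := fun k =>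
    dist_le_of_le_geometric_of_tendsto θ (C₄ * b) hθ1 hstep hlim k
  refine ⟨hlim, fun k => ?_, ?_⟩
  · have hk := hdist k
    rw [dist_eq_norm] at hk
    have hθk : 0 ≤ θ ^ k := pow_nonneg hθ0 k
    rw [Matrix.sub_mulVec, Pi.sub_apply]
    calc _ ≤ C₄ * b * θ ^ k / (1 - θ) := hk
      _ = C₄ / (1 - θ) * θ ^ k * b := by ring
      _ ≤ (C₀ + C₄ / (1 - θ)) * θ ^ k * b := by
          have : 0 ≤ C₀ * θ ^ k * b := by positivity
          nlinarith
  · have hk := hdist 0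
    rw [dist_eq_norm, pow_zero θ, mul_one] at hk
    have hc1 : ‖(A 0 *ᵥ g) i‖ ≤ C₀ * b := h0 0 g b hg i
    have htri : ‖(Matrix.of Ainf *ᵥ g) i‖ ≤ ‖(A 0 *ᵥ g) i‖ + ‖(A 0 *ᵥ g) i - (Matrix.of Ainf *ᵥ g) i‖ := by
      have := norm_sub_le ((A 0 *ᵥ g) i) ((A 0 *ᵥ g) i - (Matrix.of Ainf *ᵥ g) i)
      rwa [sub_sub_cancel] at this
    calc ‖(Matrix.of Ainf *ᵥ g) i‖ ≤ _ := htri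
      _ ≤ C₀ * b + C₄ * b / (1 - θ) := add_le_add hc1 hk
      _ = (C₀ + C₄ / (1 - θ)) * b := by ring

/-- entrywise convergence from sup-currency convergence (unit vectors). [folklore] -/
theorem tendsto_apply_of_tendsto_mulVec {ι : Type*} [Fintype ι] [DecidableEq ι] (A : ℕ → Matrix ι ι ℂ) (Ainf : Matrix ι ι ℂ)
    (h : ∀ (g : ι → ℂ) (b : ℝ), (∀ j, ‖g j‖ ≤ b) → ∀ i, Tendsto (fun k : ℕ => (A k *ᵥ g) i) atTop (nhds ((Ainf *ᵥ g) i)))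
    (i j : ι) : Tendsto (fun k : ℕ => A k i j) atTop (nhds (Ainf i j)) := by
  have := h (Pi.single j (1 : ℂ)) 1 (norm_single_one_le j) i
  simp only [mulVec_single_one_apply] at this
  exact this

/-! ## §2 The inverse's one-step law along the tower `N = L^k`, `R = L`, and the two-clause shape -/

variable (d : ℕ)

/-- **THE INVERSE's TOWER STEP, UNCONDITIONAL**: `∃ K′ > 0` (a function of `d`) such that for every `L, N₀ ≥ 1`, every `k`, every unit bond
field `g` with `|g| ≤ b` and every unit bond `i`, `‖(((c_{L^{k+1}}(1))⁻¹ − (c_{L^k}(1))⁻¹)g)(i)‖ ≤ K′·(1 + log L)·(k+1)·L^{−k}·b`. [folklore] -/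
theorem norm_covOp_inv_tower_step_le_cubic :
    ∃ K : ℝ, 0 < K ∧ ∀ (L N₀ : ℕ) [NeZero L] [NeZero N₀] (k : ℕ)
      (g : Tor (fun _ : Fin (d + 1) => N₀) × Fin (d + 1) → ℂ) (b : ℝ), (∀ j, ‖g j‖ ≤ b) →
        ∀ i : Tor (fun _ : Fin (d + 1) => N₀) × Fin (d + 1),
          ‖(((covOp (L ^ (k + 1)) (fun _ : Fin (d + 1) => N₀) 1)⁻¹ - (covOp (L ^ k) (fun _ : Fin (d + 1) => N₀) 1)⁻¹) *ᵥ g) i‖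
            ≤ K * (1 + Real.log (L : ℝ)) * ((k : ℝ) + 1) / (L : ℝ) ^ k * b := by
  obtain ⟨K, hK, h⟩ := norm_covOp_inv_succ_sub_mulVec_le_cubic d
  refine ⟨2 * K, by positivity, fun L N₀ _ _ k g b hg i => ?_⟩
  have hL : (1 : ℝ) ≤ L := by exact_mod_cast Nat.one_le_iff_ne_zero.mpr (NeZero.ne L)
  have hb : 0 ≤ b := (norm_nonneg _).trans (hg i)
  have key := h (L ^ k) L N₀ g b hg i
  rw [covOp_level_congr (pow_succ' L k) 1]
  push_cast at key
  rw [show (L : ℝ) * (L : ℝ) ^ k = (L : ℝ) ^ (k + 1) from (pow_succ' _ _).symm, Real.log_pow, Real.log_pow] at key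
  have hr := tower_rate_le hL k
  calc ‖(((covOp (L * L ^ k) (fun _ : Fin (d + 1) => N₀) 1)⁻¹ - (covOp (L ^ k) (fun _ : Fin (d + 1) => N₀) 1)⁻¹) *ᵥ g) i‖
      ≤ K * (((L : ℝ) - 1) / (L : ℝ) ^ (k + 1)) * (2 + ((k + 1 : ℕ) : ℝ) * Real.log L + (k : ℝ) * Real.log L) * b := key
    _ = K * (((L : ℝ) - 1) / (L : ℝ) ^ (k + 1) * (2 + ((k : ℝ) + 1) * Real.log L + (k : ℝ) * Real.log L)) * b := by
        push_cast; ring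
    _ ≤ K * (2 * (1 + Real.log L) * ((k : ℝ) + 1) / L ^ k) * b :=
        mul_le_mul_of_nonneg_right (mul_le_mul_of_nonneg_left hr hK.le) hb
    _ = 2 * K * (1 + Real.log (L : ℝ)) * ((k : ℝ) + 1) / (L : ℝ) ^ k * b := by ring

/-- **THE TWO-CLAUSE SHAPE FOR THE INVERSES `(c_{L^k}(1))⁻¹` ON CUBIC UNIT TORI, sup → sup, UNCONDITIONAL**: `∃ σ > 0` (a function of `d`;
leaf-03's (V-SINV) constant) and, for every `L ≥ 2`, a `C₄ > 0` (d, L) with, for every `N₀ ≥ 1`, `k`, `|g| ≤ b`, `i`: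
`‖((c_{L^k})⁻¹g)(i)‖ ≤ σ·b` and `‖(((c_{L^{k+1}})⁻¹ − (c_{L^k})⁻¹)g)(i)‖ ≤ C₄·(1∕√L)^k·b`. [folklore] -/
theorem convC_shape_covOp_inv_tower_cubic :
    ∃ σ : ℝ, 0 < σ ∧ ∀ (L : ℕ) [NeZero L], 2 ≤ L → ∃ C₄ : ℝ, 0 < C₄ ∧
      ∀ (N₀ : ℕ) [NeZero N₀] (k : ℕ) (g : Tor (fun _ : Fin (d + 1) => N₀) × Fin (d + 1) → ℂ) (b : ℝ), (∀ j, ‖g j‖ ≤ b) →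
        ∀ i : Tor (fun _ : Fin (d + 1) => N₀) × Fin (d + 1),
          ‖((covOp (L ^ k) (fun _ : Fin (d + 1) => N₀) 1)⁻¹ *ᵥ g) i‖ ≤ σ * b ∧
          ‖(((covOp (L ^ (k + 1)) (fun _ : Fin (d + 1) => N₀) 1)⁻¹ - (covOp (L ^ k) (fun _ : Fin (d + 1) => N₀) 1)⁻¹) *ᵥ g) i‖
            ≤ C₄ * ((Real.sqrt L)⁻¹) ^ k * b := by
  obtain ⟨σ, hσ, h0⟩ := covOp_inv_sup_one_cubic (d := d)
  obtain ⟨K, hK, h⟩ := norm_covOp_inv_tower_step_le_cubic d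
  refine ⟨σ, hσ, fun L _ hL2 => ?_⟩
  have hL1 : (1 : ℝ) < L := by exact_mod_cast hL2
  have hL0 : (0 : ℝ) < L := by linarith
  have hlog : 0 ≤ Real.log (L : ℝ) := Real.log_nonneg hL1.le
  set y : ℝ := (Real.sqrt L)⁻¹ with hy
  have hsq : 1 < Real.sqrt L := by
    rw [show (1 : ℝ) = Real.sqrt 1 from Real.sqrt_one.symm]
    exact Real.sqrt_lt_sqrt zero_le_one hL1
  have hy0 : 0 < y := inv_pos.mpr (by linarith)
  have hy1 : y < 1 := inv_lt_one_of_one_lt₀ hsq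
  have h1y : 0 < 1 - y := by linarith
  have hyy : ∀ k : ℕ, ((L : ℝ) ^ k)⁻¹ = y ^ k * y ^ k := fun k => by
    rw [hy, ← mul_pow, ← mul_inv, Real.mul_self_sqrt hL0.le, inv_pow]
  refine ⟨K * (1 + Real.log L) / (1 - y), by positivity, ?_⟩
  intro N₀ _ k g b hg i
  have hb : 0 ≤ b := (norm_nonneg _).trans (hg i)
  refine ⟨h0 (L ^ k) N₀ (Nat.one_le_iff_ne_zero.mpr (NeZero.ne _)) g b hg i, ?_⟩
  have h2 := h L N₀ k g b hg i
  have hgeo := succ_mul_pow_le hy0.le hy1 k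
  have hyk : 0 ≤ y ^ k := pow_nonneg hy0.le k
  have hcoef : K * (1 + Real.log (L : ℝ)) * ((k : ℝ) + 1) / (L : ℝ) ^ k ≤ K * (1 + Real.log L) / (1 - y) * y ^ k :=
    calc K * (1 + Real.log (L : ℝ)) * ((k : ℝ) + 1) / (L : ℝ) ^ k
        = K * (1 + Real.log (L : ℝ)) * (((k : ℝ) + 1) * y ^ k) * y ^ k := by
          rw [div_eq_mul_inv, hyy k]; ring
      _ ≤ K * (1 + Real.log (L : ℝ)) * (1 / (1 - y)) * y ^ k :=
          mul_le_mul_of_nonneg_right (mul_le_mul_of_nonneg_left hgeo (by positivity)) hyk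
      _ = K * (1 + Real.log L) / (1 - y) * y ^ k := by ring
  exact h2.trans (mul_le_mul_of_nonneg_right hcoef hb)

/-! ## §3 The limit of the inverses along the tower -/

/-- **THE TOWER LIMIT OF `(Q_k𝒢_kQ_k*)⁻¹` ON A CUBIC UNIT TORUS, `U = 1`, `a = 1`, UNCONDITIONAL.**  For every `L ≥ 2` there is `C₅ > 0` (a function of
`d, L`) such that on every cubic unit torus `T = Π_{μ<d+1} ℤ∕N₀` there is a matrix `d_∞` on the unit bonds with, for every `|g| ≤ b` and every unit bond `i`:
`((c_{L^k}(1))⁻¹g)(i) → (d_∞g)(i)`, `‖(((c_{L^k}(1))⁻¹ − d_∞)g)(i)‖ ≤ C₅·(1∕√L)^k·b` for every `k`, and `‖(d_∞g)(i)‖ ≤ C₅·b`; `C₅ = σ + C₄∕(1 − 1∕√L)`. [folklore] -/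
theorem tendsto_covOp_inv_tower_cubic :
    ∀ (L : ℕ) [NeZero L], 2 ≤ L → ∃ C₅ : ℝ, 0 < C₅ ∧
      ∀ (N₀ : ℕ) [NeZero N₀],
        ∃ dinf : Matrix (Tor (fun _ : Fin (d + 1) => N₀) × Fin (d + 1)) (Tor (fun _ : Fin (d + 1) => N₀) × Fin (d + 1)) ℂ,
          ∀ (g : Tor (fun _ : Fin (d + 1) => N₀) × Fin (d + 1) → ℂ) (b : ℝ), (∀ j, ‖g j‖ ≤ b) →
            ∀ i : Tor (fun _ : Fin (d + 1) => N₀) × Fin (d + 1),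
              Tendsto (fun k : ℕ => ((covOp (L ^ k) (fun _ : Fin (d + 1) => N₀) 1)⁻¹ *ᵥ g) i) atTop (nhds ((dinf *ᵥ g) i)) ∧
              (∀ k : ℕ, ‖(((covOp (L ^ k) (fun _ : Fin (d + 1) => N₀) 1)⁻¹ - dinf) *ᵥ g) i‖ ≤ C₅ * ((Real.sqrt L)⁻¹) ^ k * b) ∧
              ‖(dinf *ᵥ g) i‖ ≤ C₅ * b := by
  intro L _ hL2
  obtain ⟨σ, hσ, hall⟩ := convC_shape_covOp_inv_tower_cubic d
  obtain ⟨C₄, hC₄, h⟩ := hall L hL2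
  have hL1 : (1 : ℝ) < L := by exact_mod_cast hL2
  have hsq : 1 < Real.sqrt L := by
    rw [show (1 : ℝ) = Real.sqrt 1 from Real.sqrt_one.symm]
    exact Real.sqrt_lt_sqrt zero_le_one hL1
  have hθ0 : 0 ≤ (Real.sqrt (L : ℝ))⁻¹ := inv_nonneg.mpr (Real.sqrt_nonneg _)
  have hθ1 : (Real.sqrt (L : ℝ))⁻¹ < 1 := inv_lt_one_of_one_lt₀ hsq
  have h1θ : 0 < 1 - (Real.sqrt (L : ℝ))⁻¹ := by linarith
  refine ⟨σ + C₄ / (1 - (Real.sqrt L)⁻¹), by positivity, fun N₀ _ => ?_⟩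
  exact tower_limit_of_bounds (fun k => (covOp (L ^ k) (fun _ : Fin (d + 1) => N₀) 1)⁻¹) hσ.le hθ0 hθ1
    (fun k g b hg i => (h N₀ k g b hg i).1) (fun k g b hg i => (h N₀ k g b hg i).2)

/-! ## §4 The identification `d_∞ = c_∞⁻¹` -/

/-- **limits of inverses on a finite carrier**: if `A_k → c` and `A_k⁻¹ → d` ENTRYWISE and every `A_k` is invertible (`A_k·A_k⁻¹ = 1`), then
`c·d = 1` (the finite sum `Σ_l A_k(i,l)A_k⁻¹(l,j)` passes to the limit; uniqueness of limits in `ℂ`). [folklore] -/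
theorem mul_eq_one_of_tendsto {ι : Type*} [Fintype ι] [DecidableEq ι] (A : ℕ → Matrix ι ι ℂ) (cinf dinf : Matrix ι ι ℂ)
    (hA : ∀ k, A k * (A k)⁻¹ = 1)
    (hc : ∀ i j, Tendsto (fun k : ℕ => A k i j) atTop (nhds (cinf i j)))
    (hd : ∀ i j, Tendsto (fun k : ℕ => (A k)⁻¹ i j) atTop (nhds (dinf i j))) : cinf * dinf = 1 := by
  ext i j
  have hlim : Tendsto (fun k : ℕ => (A k * (A k)⁻¹) i j) atTop (nhds ((cinf * dinf) i j)) := by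
    simp only [Matrix.mul_apply]
    exact tendsto_finsetSum _ fun l _ => (hc i l).mul (hd l j)
  have hone : (fun k : ℕ => (A k * (A k)⁻¹) i j) = fun _ => (1 : Matrix ι ι ℂ) i j := by
    funext k; rw [hA k]
  rw [hone] at hlim
  exact tendsto_nhds_unique hlim tendsto_const_nhds

/-- **THE LIMIT OF THE INVERSES IS THE INVERSE OF THE LIMIT** (entrywise form).  For every `L ≥ 2` and every cubic unit torus there are `c_∞`
(p266003's limit of `c_{L^k}(1)`) and `d_∞` (§3's limit of `(c_{L^k}(1))⁻¹`) with `c_{L^k}(1) → c_∞` and `(c_{L^k}(1))⁻¹ → d_∞` ENTRYWISE,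
`c_∞·d_∞ = 1` and `c_∞⁻¹ = d_∞` (`isUnit_covOp_det` at every level; `mul_eq_one_of_tendsto`; `Matrix.inv_eq_right_inv`). [folklore] -/
theorem tendsto_covOp_tower_inv_eq (L : ℕ) [NeZero L] (hL2 : 2 ≤ L) (N₀ : ℕ) [NeZero N₀] :
    ∃ cinf dinf : Matrix (Tor (fun _ : Fin (d + 1) => N₀) × Fin (d + 1)) (Tor (fun _ : Fin (d + 1) => N₀) × Fin (d + 1)) ℂ,
      (∀ i j, Tendsto (fun k : ℕ => covOp (L ^ k) (fun _ : Fin (d + 1) => N₀) 1 i j) atTop (nhds (cinf i j))) ∧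
      (∀ i j, Tendsto (fun k : ℕ => (covOp (L ^ k) (fun _ : Fin (d + 1) => N₀) 1)⁻¹ i j) atTop (nhds (dinf i j))) ∧
      cinf * dinf = 1 ∧ cinf⁻¹ = dinf := by
  obtain ⟨C₅, -, hc⟩ := tendsto_covOp_tower_cubic d L hL2
  obtain ⟨cinf, hcinf⟩ := hc N₀
  obtain ⟨D₅, -, hd⟩ := tendsto_covOp_inv_tower_cubic d L hL2
  obtain ⟨dinf, hdinf⟩ := hd N₀
  have hce : ∀ i j, Tendsto (fun k : ℕ => covOp (L ^ k) (fun _ : Fin (d + 1) => N₀) 1 i j) atTop (nhds (cinf i j)) :=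
    tendsto_apply_of_tendsto_mulVec _ cinf fun g b hg i => (hcinf g b hg i).1
  have hde : ∀ i j, Tendsto (fun k : ℕ => (covOp (L ^ k) (fun _ : Fin (d + 1) => N₀) 1)⁻¹ i j) atTop (nhds (dinf i j)) :=
    tendsto_apply_of_tendsto_mulVec _ dinf fun g b hg i => (hdinf g b hg i).1
  have hprod : cinf * dinf = 1 :=
    mul_eq_one_of_tendsto _ cinf dinf
      (fun k => Matrix.mul_nonsing_inv _ (isUnit_covOp_det (L ^ k) (fun _ : Fin (d + 1) => N₀) one_pos)) hce hde
  exact ⟨cinf, dinf, hce, hde, hprod, Matrix.inv_eq_right_inv hprod⟩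

/-- **THE VECTOR CONSTITUENT AND ITS INVERSE ALONG THE TOWER — ONE PACKAGE** (sup → sup, cubic unit tori, `U = 1`, `a = 1`, UNCONDITIONAL):
for every `L ≥ 2` there is `C > 0` (d, L) such that for every `N₀ ≥ 1` there are `c_∞`, `d_∞` on the unit bonds with **`c_∞⁻¹ = d_∞`** and, for
every `|g| ≤ b` and every unit bond `i`: `(c_{L^k}g)(i) → (c_∞g)(i)`, `‖((c_{L^k} − c_∞)g)(i)‖ ≤ C(1∕√L)^k b`, `‖(c_∞g)(i)‖ ≤ C b`, and the same
three clauses for `(c_{L^k})⁻¹ → d_∞` — the two limits NAMED in ONE statement so a consumer's single `obtain` sees that they are mutually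
inverse. [folklore] -/
theorem tendsto_covOp_and_inv_tower_cubic :
    ∀ (L : ℕ) [NeZero L], 2 ≤ L → ∃ C : ℝ, 0 < C ∧
      ∀ (N₀ : ℕ) [NeZero N₀],
        ∃ cinf dinf : Matrix (Tor (fun _ : Fin (d + 1) => N₀) × Fin (d + 1)) (Tor (fun _ : Fin (d + 1) => N₀) × Fin (d + 1)) ℂ,
          cinf⁻¹ = dinf ∧ cinf * dinf = 1 ∧
          ∀ (g : Tor (fun _ : Fin (d + 1) => N₀) × Fin (d + 1) → ℂ) (b : ℝ), (∀ j, ‖g j‖ ≤ b) →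
            ∀ i : Tor (fun _ : Fin (d + 1) => N₀) × Fin (d + 1),
              (Tendsto (fun k : ℕ => (covOp (L ^ k) (fun _ : Fin (d + 1) => N₀) 1 *ᵥ g) i) atTop (nhds ((cinf *ᵥ g) i)) ∧
                (∀ k : ℕ, ‖((covOp (L ^ k) (fun _ : Fin (d + 1) => N₀) 1 - cinf) *ᵥ g) i‖ ≤ C * ((Real.sqrt L)⁻¹) ^ k * b) ∧
                ‖(cinf *ᵥ g) i‖ ≤ C * b) ∧
              (Tendsto (fun k : ℕ => ((covOp (L ^ k) (fun _ : Fin (d + 1) => N₀) 1)⁻¹ *ᵥ g) i) atTop (nhds ((dinf *ᵥ g) i)) ∧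
                (∀ k : ℕ, ‖(((covOp (L ^ k) (fun _ : Fin (d + 1) => N₀) 1)⁻¹ - dinf) *ᵥ g) i‖ ≤ C * ((Real.sqrt L)⁻¹) ^ k * b) ∧
                ‖(dinf *ᵥ g) i‖ ≤ C * b) := by
  intro L _ hL2
  obtain ⟨C₅, hC₅, hc⟩ := tendsto_covOp_tower_cubic d L hL2
  obtain ⟨D₅, hD₅, hd⟩ := tendsto_covOp_inv_tower_cubic d L hL2
  refine ⟨max C₅ D₅, lt_max_of_lt_left hC₅, fun N₀ _ => ?_⟩
  obtain ⟨cinf, hcinf⟩ := hc N₀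
  obtain ⟨dinf, hdinf⟩ := hd N₀
  have hce : ∀ i j, Tendsto (fun k : ℕ => covOp (L ^ k) (fun _ : Fin (d + 1) => N₀) 1 i j) atTop (nhds (cinf i j)) :=
    tendsto_apply_of_tendsto_mulVec _ cinf fun g b hg i => (hcinf g b hg i).1
  have hde : ∀ i j, Tendsto (fun k : ℕ => (covOp (L ^ k) (fun _ : Fin (d + 1) => N₀) 1)⁻¹ i j) atTop (nhds (dinf i j)) :=
    tendsto_apply_of_tendsto_mulVec _ dinf fun g b hg i => (hdinf g b hg i).1
  have hprod : cinf * dinf = 1 :=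
    mul_eq_one_of_tendsto _ cinf dinf
      (fun k => Matrix.mul_nonsing_inv _ (isUnit_covOp_det (L ^ k) (fun _ : Fin (d + 1) => N₀) one_pos)) hce hde
  refine ⟨cinf, dinf, Matrix.inv_eq_right_inv hprod, hprod, fun g b hg i => ⟨?_, ?_⟩⟩
  · obtain ⟨h1, h2, h3⟩ := hcinf g b hg i
    have hb : 0 ≤ b := (norm_nonneg _).trans (hg i)
    have hθ : ∀ k : ℕ, 0 ≤ ((Real.sqrt (L : ℝ))⁻¹) ^ k := fun k => pow_nonneg (inv_nonneg.mpr (Real.sqrt_nonneg _)) k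
    exact ⟨h1, fun k => (h2 k).trans (by gcongr; exact le_max_left _ _), h3.trans (by gcongr; exact le_max_left _ _)⟩
  · obtain ⟨h1, h2, h3⟩ := hdinf g b hg i
    have hb : 0 ≤ b := (norm_nonneg _).trans (hg i)
    have hθ : ∀ k : ℕ, 0 ≤ ((Real.sqrt (L : ℝ))⁻¹) ^ k := fun k => pow_nonneg (inv_nonneg.mpr (Real.sqrt_nonneg _)) k
    exact ⟨h1, fun k => (h2 k).trans (by gcongr; exact le_max_right _ _), h3.trans (by gcongr; exact le_max_right _ _)⟩

/-! ## §5 The NE2 reading: `covBlev` and `Δ_K^{(k)}` along the tower, in sup → sup currency -/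

section NE2Reading

variable (L : ℕ) [NeZero L]

/-- NE2's tower object at `a = 1` IS road P2's: `covBlev L T 1 _ k = covOp (L^k) T 1` (`covBlev = covB (lev L k)`, `covOp_eq_covB`, NE2's `VariationalDelKBridge.lev_eq_pow`).
[folklore] -/
theorem covBlev_one_eq_covOp {d' : ℕ} (M : Fin d' → ℕ) [∀ μ, NeZero (M μ)] (k : ℕ) :
    covBlev L M 1 one_pos k = covOp (L ^ k) M 1 := by
  rw [covBlev, ← covOp_eq_covB (lev L k) (one_le_lev' L k) M 1 one_pos, covOp_level_congr (lev_eq_pow L k) 1]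

/-- **`Δ_K^{(k)}(a = 1) = (c_{L^k}(1))⁻¹ − 1`** (`BalabanHardMinimizer.DeltaKlev`). [folklore] -/
theorem DeltaKlev_one_eq {d' : ℕ} (M : Fin d' → ℕ) [∀ μ, NeZero (M μ)] (k : ℕ) :
    DeltaKlev L M 1 one_pos k = (covOp (L ^ k) M 1)⁻¹ - (1 : Matrix (Tor M × Fin d') (Tor M × Fin d') ℂ) := by
  rw [DeltaKlev, covBlev_one_eq_covOp]
  simp

/-- **NE2's HARD EFFECTIVE OPERATORS CONVERGE IN sup → sup CURRENCY, UNIFORMLY IN THE CUBIC UNIT TORUS** (`U = 1`, `a = 1`): for every `L ≥ 2`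
there is `C₅ > 0` (d, L) such that for every `N₀ ≥ 1` there is `Δ_∞ = d_∞ − 1` with, for all `|g| ≤ b` and unit bonds `i`,
`(Δ_K^{(k)}g)(i) → (Δ_∞g)(i)` and `‖((Δ_K^{(k)} − Δ_∞)g)(i)‖ ≤ C₅·(1∕√L)^k·b` — the ℓ^∞ companion of `BalabanHardMinimizer.DeltaKlev_tendsto`
(ℓ²-operator norm, every torus, every `a`). [folklore] -/
theorem tendsto_DeltaKlev_one_cubic (hL2 : 2 ≤ L) :
    ∃ C₅ : ℝ, 0 < C₅ ∧ ∀ (N₀ : ℕ) [NeZero N₀],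
      ∃ Dinf : Matrix (Tor (fun _ : Fin (d + 1) => N₀) × Fin (d + 1)) (Tor (fun _ : Fin (d + 1) => N₀) × Fin (d + 1)) ℂ,
        ∀ (g : Tor (fun _ : Fin (d + 1) => N₀) × Fin (d + 1) → ℂ) (b : ℝ), (∀ j, ‖g j‖ ≤ b) →
          ∀ i : Tor (fun _ : Fin (d + 1) => N₀) × Fin (d + 1),
            Tendsto (fun k : ℕ => (DeltaKlev L (fun _ : Fin (d + 1) => N₀) 1 one_pos k *ᵥ g) i) atTop (nhds ((Dinf *ᵥ g) i)) ∧
            ∀ k : ℕ, ‖((DeltaKlev L (fun _ : Fin (d + 1) => N₀) 1 one_pos k - Dinf) *ᵥ g) i‖ ≤ C₅ * ((Real.sqrt L)⁻¹) ^ k * b := by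
  obtain ⟨C₅, hC₅, h⟩ := tendsto_covOp_inv_tower_cubic d L hL2
  refine ⟨C₅, hC₅, fun N₀ _ => ?_⟩
  obtain ⟨dinf, hd⟩ := h N₀
  refine ⟨dinf - 1, fun g b hg i => ⟨?_, fun k => ?_⟩⟩
  · have h1 := (hd g b hg i).1
    simp only [DeltaKlev_one_eq, Matrix.sub_mulVec, Pi.sub_apply]
    exact h1.sub tendsto_const_nhds
  · have h2 := (hd g b hg i).2.1 k
    rwa [DeltaKlev_one_eq, sub_sub_sub_cancel_right]

end NE2Reading

end Summit.QuantumFields.BalabanUV.Beta.GAN24.AveragedPropagatorInverseTowerCubic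

end
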